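import Summits.BirchSwinnertonDyer.Rank1Residual.X2.ResidualDevissageSelmer
import Summits.BirchSwinnertonDyer.Rank1Residual.X2.ResidualDevissageModules
import Summits.BirchSwinnertonDyer.Rank1Residual.X2.TateLineDecomposition
import Summits.BirchSwinnertonDyer.Rank1Residual.X2.GreenbergVatsalTorsionCurve
import Literature.NumberTheory.EllipticCurves.Rank1Residual.GVParityLineTypeProofs
import Literature.NumberTheory.EllipticCurves.Rank1Residual.GVParityIsogenyConjugationProofs
import Literature.NumberTheory.EllipticCurves.RationalIsogenyDegreesProofs
import HarnessLib

/-!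
# Greenberg–Vatsal 2000, §2 display (16) at an Eisenstein prime of an elliptic curve over `ℚ`:
# the devissage of `S^{Σ₀}_{E[p]}(L)` along the RAMIFIED-EVEN RATIONAL LINE `Φ = C[p]`
# (instantiation of `X2/ResidualDevissageSelmer` on the residual Greenberg datum)

HONEST FRAMING (cell `b2b-bsdres`, run/shared/lean/b2b/bsd-rank1-residual/, verbatim in every
file): the goal of the cell is to DELETE the COMBINATION-SHAPED residual classes of the
Birch–Swinnerton-Dyer formula for ALL analytic-rank `≤ 1` elliptic curves over `ℚ` — "full BSD
formula for every rank `≤ 1` curve in class `C`" assembled STRICTLY from published theorems — so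
that the rank-`≤ 1` remainder becomes exactly the CONSTRUCTION-SHAPED classes, which are TYPED
(missing-input `Prop`s), NOT attempted. This is not "finishing BSD". Sub-cell
`b2b-bsdres-eisenstein-p2` (CLASS-OWNERS row "X2"), gen 16: research route; NO CLAIM BEYOND STATED
CLASSES; nothing here changes a label; no named fact; every `def` has a body.

WHAT (GV arXiv:math/9906215 p. 28: "`E[p]` contains a `G_ℚ`-invariant subgroup `Φ` … either
ramified and even, or unramified and odd … In the first case `Φ = C[p]` … `Ψ = E[p]/Φ` … `ψ` is
odd"). For `E/ℚ`, an odd prime `p`, a RATIONAL LINE `Φ₀ ≤ E[p]` (`IsRationalLine`) that is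
RAMIFIED at `p` (`¬ LineUnramifiedAt`) and EVEN (`LineEven`) — the first Greenberg–Vatsal case
of `GVPar` — and ANY Greenberg data `L` on `E[p^∞]` above `p` whose graded piece is inertially
trivial (`htriv`: GV "`I_p` acts trivially on `D`") with residual line of order `p`
(`hcard`: `#(C ∩ E[p^∞][p]) = p`) — both DISCHARGED in the tree for Greenberg's reduction datum at
a good ordinary `p` (gens 9, 11) and for the TATE datum at `p ‖ N` (gens 9, 12, 13:
`GreenbergVatsalTateDatumCofree.exists_data_of_{not_,}split`, modulo the Tate uniformisation
A40/A41) —: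
* §1 `torsionToPrimary : E[p] = E(ℚ̄)[p] ≃ E[p^∞][p]` (equivariant, bijective) and the line
  `lineSub Φ₀` transported to `E[p^∞][p]` as a `Γ_ℚ`-stable subgroup (`StableSubgroup`);
* §2 **`torsionData_plus_eq_lineSub`**: the residual datum `C ∩ E[p^∞][p]` IS `Φ₀` (a ramified
  rational line is Serre's inertia line: tree `eq_of_not_lineUnramifiedAt`) — GV "`Φ = C[p]`";
* §3 **`smul_quot_eq_neg_of_lineEven`**: every complex conjugation acts as `−1` on `E[p]/Φ₀`
  (`det ρ̄(c) = −1` via the tree's Weil-pairing eigenvector theorem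
  `exists_fixed_and_antifixed_of_isComplexConjugation`; `E[p] = Φ₀ ⊕ ℤQ` for an anti-fixed `Q`)
  — GV "`ψ` is odd"; hence `(E[p]/Φ₀)^H = 0` for every `H ≤ Γ_ℚ` containing a complex
  conjugation (`forall_fixed_quot_eq_zero`), e.g. `H = Gal(ℚ̄/ℚ_∞)`
  (`mem_kerSubgroup_of_isComplexConjugation`); and `eq_zero_of_forall_smul_eq`: in this case
  `E[p]^{Γ_ℚ} = 0` (GV's "`H⁰(ℚ, A[π]) = 0`" of Prop. (2.8) is automatic);
* §4 **`natCard_gvSelmer_torsion_eq_mul_of_line`**: for every normal `H ≤ Γ_ℚ` containing a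
  complex conjugation and `Σ₀ ⊇` the bad places prime to `p`,
  `#S^{Σ₀}_{E[p]}(L) = #H¹(ℚ_Σ/L, Φ₀) · #S^{Σ₀}_{E[p]/Φ₀}(L)`, modulo ONE hypothesis — the
  lifting property `S^{Σ₀}_{E[p]/Φ₀}(L) ⊆ q_* H¹(ℚ_Σ/L, E[p])` (GV pp. 29–30:
  "`H²(ℚ_Σ/ℚ_∞, Φ) = 0`", Ferrero–Washington + Iwasawa + Greenberg 1999 Prop. 4;
  character-theoretic, not about `E`). This is the `E`-dependent step of display (16),
  `dim S^{Σ₀}_{E[p]}(ℚ_∞) = λ_{φ,Σ₀} + λ_{ψ,Σ₀}`, as a KERNEL theorem valid verbatim at `p ‖ N`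
  (flag `GV00-mult-asserted` of the X2a closure: the paragraph of (16) is printed under "good
  ordinary"; its `E`-inputs are now tree theorems for the Tate datum).

References: Greenberg–Vatsal, Invent. Math. 142 (2000) 17–63 = arXiv:math/9906215, §2 pp. 14–16,
25, 28–30; Greenberg, LNM 1716 (1999) §2; Serre, Invent. Math. 15 (1972) §1.11; McCallum 1991 §3.
-/

noncomputable section

open scoped Classical AddSubgroup

namespace Summit.BirchSwinnertonDyer.Rank1Residual.X2.ResidualDevissageLine

open WeierstrassCurve Literature.NumberTheory.EllipticCurves Literature.NumberTheory.GaloisRepresentations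
  Field IsDedekindDomain NumberField
  Literature.NumberTheory.EllipticCurves.GreenbergSelmer
  Literature.NumberTheory.EllipticCurves.Rank1Residual
  Summit.BirchSwinnertonDyer.Rank1Residual.X2.GreenbergVatsalTorsion
  Summit.BirchSwinnertonDyer.Rank1Residual.X2.GreenbergVatsalTateDatumCofree
  Summit.BirchSwinnertonDyer.Rank1Residual.X2.ResidualDevissageModules
  Summit.BirchSwinnertonDyer.Rank1Residual.X2.ResidualDevissageSelmer

variable (W : WeierstrassCurve ℚ) (p : ℕ) [hp : Fact p.Prime]

/-! ## §1. `E[p] ≃ E[p^∞][p]` and the transported line -/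

/-- The equivariant identification `E(ℚ̄)[p] → E[p^∞][p]` (same points). [folklore] -/
def torsionToPrimary : ↥(geomTorsion W (p : ℤ)) →+ ↥((↥(W.geomPrimaryTorsion p))[(p : ℤ)]) where
  toFun P := ⟨AddSubgroup.inclusion (geomTorsion_le_geomPrimaryTorsion W p) P,
    (TateLineDecomposition.mem_torsionBy_primary_iff W p _).mpr
      (AddSubgroup.torsionBy.nsmul_iff.mp P.2)⟩
  map_zero' := rfl
  map_add' _ _ := rfl

omit hp in
/-- `torsionToPrimary` on underlying points. [folklore] -/
@[simp]
theorem coe_coe_torsionToPrimary (P : geomTorsion W (p : ℤ)) :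
    (((torsionToPrimary W p P : (↥(W.geomPrimaryTorsion p))[(p : ℤ)]) : W.geomPrimaryTorsion p) :
      W.geomPoints) = (P : W.geomPoints) :=
  rfl

omit hp in
/-- `torsionToPrimary` is `Γ_ℚ`-equivariant. [folklore] -/
theorem torsionToPrimary_smul (g : absoluteGaloisGroup ℚ) (P : geomTorsion W (p : ℤ)) :
    torsionToPrimary W p (g • P) = g • torsionToPrimary W p P :=
  Subtype.ext (Subtype.ext rfl)

omit hp in
/-- `torsionToPrimary` is bijective. [folklore] -/
theorem torsionToPrimary_bijective : Function.Bijective (torsionToPrimary W p) := by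
  constructor
  · intro P Q h
    apply Subtype.ext
    have := congrArg (fun m : (↥(W.geomPrimaryTorsion p))[(p : ℤ)] ↦
      ((m : W.geomPrimaryTorsion p) : W.geomPoints)) h
    exact this
  · intro m
    refine ⟨⟨((m : W.geomPrimaryTorsion p) : W.geomPoints),
      AddSubgroup.torsionBy.nsmul_iff.mpr
        ((TateLineDecomposition.mem_torsionBy_primary_iff W p m.1).mp m.2)⟩, rfl⟩

variable {W p} in
/-- **The rational line `Φ₀ ≤ E[p]` transported to `E[p^∞][p]`, as a `Γ_ℚ`-stable subgroup**
(GV p. 28 "a `G_ℚ`-invariant subgroup `Φ` of order `p`"). [cite: GreenbergVatsal2000, §2 p. 28] -/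
def lineSub (Φ₀ : AddSubgroup (geomTorsion W (p : ℤ))) (hΦ : IsRationalLine W p Φ₀) :
    StableSubgroup (absoluteGaloisGroup ℚ) ↥((↥(W.geomPrimaryTorsion p))[(p : ℤ)]) where
  toAddSubgroup := Φ₀.map (torsionToPrimary W p)
  smul_mem' g {m} hm := by
    obtain ⟨P, hP, rfl⟩ := hm
    exact ⟨g • P, hΦ.2 g P hP, torsionToPrimary_smul W p g P⟩

variable {W p}
variable {Φ₀ : AddSubgroup (geomTorsion W (p : ℤ))} (hΦ : IsRationalLine W p Φ₀)

/-- Membership in the transported line. [folklore] -/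
theorem torsionToPrimary_mem_lineSub_iff (P : geomTorsion W (p : ℤ)) :
    torsionToPrimary W p P ∈ (lineSub Φ₀ hΦ).toAddSubgroup ↔ P ∈ Φ₀ := by
  constructor
  · rintro ⟨Q, hQ, hQP⟩
    rwa [← (torsionToPrimary_bijective W p).1 hQP]
  · exact fun hP ↦ ⟨P, hP, rfl⟩

/-! ## §2. The residual datum IS the ramified rational line (`Φ = C[p]`) -/

/-- **`C ∩ E[p^∞][p] = Φ₀`** for every Greenberg datum `N` above `p` with inertially trivial
graded piece (`htriv`) and residual line of order `p` (`hcard`), and every rational line `Φ₀`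
RAMIFIED at `p`: Serre's inertia line `X₀ = C ∩ E[p]` (order `p`, `σ • P − P ∈ X₀` for `σ` in
the inertia group of `𝔓₀ = adicCompletionPrime ℚ v`, Neukirch II (9.6)) equals any ramified
rational line (tree `eq_of_not_lineUnramifiedAt`). GV p. 28 "`Φ = C[p]`"; Serre 1972 §1.11.
[cite: GreenbergVatsal2000, §2 p. 28] -/
theorem torsionData_plus_eq_lineSub (hram : ¬ LineUnramifiedAt W p Φ₀)
    {v : HeightOneSpectrum (𝓞 ℚ)} (hv : ((p : ℕ) : 𝓞 ℚ) ∈ v.asIdeal)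
    (N : LocalDatum ℚ (W.geomPrimaryTorsion p) v)
    (htriv : ∀ x ∈ inertia v, ∀ m : W.geomPrimaryTorsion p, x • m - m ∈ N.plus)
    (hcard : Nat.card ↥(N.plus ⊓ (↥(W.geomPrimaryTorsion p))[(p : ℤ)]) = p) :
    (torsionDatum N p).plus = (lineSub Φ₀ hΦ).toAddSubgroup := by
  -- Serre's line inside `E[p]`
  set X : AddSubgroup (geomTorsion W (p : ℤ)) :=
    N.plus.comap (AddSubgroup.inclusion (geomTorsion_le_geomPrimaryTorsion W p)) with hX
  have hXcard : Nat.card X = p := by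
    rw [hX, TateLineDecomposition.natCard_comap_eq W p N, hcard]
  have hXsub : ∀ σ ∈ (adicCompletionPrime ℚ v).inertia (absoluteGaloisGroup ℚ),
      ∀ P : geomTorsion W (p : ℤ), σ • P - P ∈ X := by
    intro σ hσ P
    rw [inertia_adicCompletionPrime_eq_map_absInertia] at hσ
    rw [hX, TateLineDecomposition.mem_comap_iff, map_sub, TateLineDecomposition.inclusion_smul]
    exact htriv σ hσ _
  have hΦX : Φ₀ = X :=
    eq_of_not_lineUnramifiedAt hΦ hram hv (adicCompletionPrime_mem_primesAbove ℚ v) hXcard hXsub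
  -- compare inside `E[p^∞][p]`
  ext m
  obtain ⟨P, rfl⟩ := (torsionToPrimary_bijective W p).2 m
  rw [torsionToPrimary_mem_lineSub_iff, hΦX, hX, TateLineDecomposition.mem_comap_iff]
  rfl

/-! ## §3. Complex conjugation acts as `−1` on `E[p]/Φ₀` for an EVEN line (`ψ` odd) -/

variable [W.IsElliptic]

omit hp in
/-- In a group killed by the odd number `p`, `2 • Q = 0` forces `Q = 0`. [folklore] -/
theorem eq_zero_of_two_nsmul_eq_zero {A : Type*} [AddCommGroup A] (hp2 : Odd p) (Q : A)
    (hpQ : p • Q = 0) (h2 : 2 • Q = 0) : Q = 0 := by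
  obtain ⟨k, hk⟩ := hp2
  rw [hk, add_nsmul, mul_nsmul', smul_comm (2 : ℕ) k Q, h2, smul_zero, zero_add, one_nsmul] at hpQ
  exact hpQ

omit hp [W.IsElliptic] in
/-- `p • Q = 0` in the subtype `E[p]`. [folklore] -/
theorem nsmul_eq_zero_of_mem_geomTorsion (Q : geomTorsion W (p : ℤ)) : p • Q = 0 := by
  apply Subtype.ext
  rw [AddSubmonoidClass.coe_nsmul, ZeroMemClass.coe_zero]
  exact AddSubgroup.torsionBy.nsmul_iff.mp Q.2

include hΦ in
/-- **`c • P + P ∈ Φ₀` for every `P ∈ E[p]`**, `c` a complex conjugation, `Φ₀` an EVEN rational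
line, `p` odd: the anti-fixed eigenvector `Q` of `c` (`det ρ̄_{E,p}(c) = −1`, tree
`exists_fixed_and_antifixed_of_isComplexConjugation`) is not in `Φ₀`, so `E[p] = Φ₀ ⊕ ℤQ` and
`c` acts as `−1` on `E[p]/Φ₀`. GV p. 28: "`ψ = ωφ⁻¹` … `ψ` is odd". [cite: GreenbergVatsal2000, §2 pp. 28–29] -/
theorem smul_add_self_mem_of_lineEven (hp2 : p ≠ 2) (heven : LineEven W p Φ₀)
    {c : absoluteGaloisGroup ℚ} (hc : IsComplexConjugation (Rat.castHom ℝ) c)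
    (P : geomTorsion W (p : ℤ)) : c • P + P ∈ Φ₀ := by
  have hpr : p.Prime := Fact.out
  have hodd : Odd p := hpr.odd_of_ne_two hp2
  obtain ⟨-, Q, hQ0, hcQ⟩ := exists_fixed_and_antifixed_of_isComplexConjugation W hp2 c hc
  -- `Q ∉ Φ₀`
  have hQΦ : Q ∉ Φ₀ := fun hQ ↦ hQ0 <| by
    refine eq_zero_of_two_nsmul_eq_zero hodd Q (nsmul_eq_zero_of_mem_geomTorsion Q) ?_
    · rw [two_nsmul]
      nth_rewrite 1 [← heven c hc Q hQ]
      rw [hcQ, neg_add_cancel]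
  -- `ℤQ` has order `p` and `Φ₀ ⊔ ℤQ = E[p]`
  have hQord : addOrderOf Q = p := addOrderOf_eq_prime (nsmul_eq_zero_of_mem_geomTorsion Q) hQ0
  have hZQ : Nat.card (AddSubgroup.zmultiples Q) = p := by rw [Nat.card_zmultiples, hQord]
  have hne : Φ₀ ≠ AddSubgroup.zmultiples Q := fun h ↦
    hQΦ (h ▸ AddSubgroup.mem_zmultiples Q)
  have htop : Φ₀ ⊔ AddSubgroup.zmultiples Q = ⊤ :=
    sup_eq_top_of_ne (W.natCard_geomTorsion_eq_sq (Nat.cast_ne_zero.2 hpr.ne_zero)) hΦ.1 hZQ hne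
  have hP : P ∈ Φ₀ ⊔ AddSubgroup.zmultiples Q := htop ▸ AddSubgroup.mem_top P
  obtain ⟨y, hy, z, hz, rfl⟩ := AddSubgroup.mem_sup.mp hP
  obtain ⟨k, rfl⟩ := AddSubgroup.mem_zmultiples_iff.mp hz
  have hcz : c • (k • Q) = -(k • Q) := by
    change DistribSMul.toAddMonoidHom (geomTorsion W (p : ℤ)) c (k • Q) = _
    rw [map_zsmul, DistribSMul.toAddMonoidHom_apply, hcQ, smul_neg]
  rw [smul_add, heven c hc y hy, hcz]
  have : y + -(k • Q) + (y + k • Q) = y + y := by abel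
  rw [this]
  exact Φ₀.add_mem hy hy

/-- **Complex conjugation acts as `−1` on `E[p]/Φ₀`** (`Φ₀` even, `p` odd).
[cite: GreenbergVatsal2000, §2 pp. 28–29] -/
theorem smul_quot_eq_neg_of_lineEven (hp2 : p ≠ 2) (heven : LineEven W p Φ₀)
    {c : absoluteGaloisGroup ℚ} (hc : IsComplexConjugation (Rat.castHom ℝ) c)
    (y : (lineSub Φ₀ hΦ).Quot) : c • y = -y := by
  refine ((lineSub Φ₀ hΦ).forall_smul_quot_eq_neg_iff c).2 (fun m ↦ ?_) y
  obtain ⟨P, rfl⟩ := (torsionToPrimary_bijective W p).2 m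
  rw [← torsionToPrimary_smul, ← map_add, torsionToPrimary_mem_lineSub_iff]
  exact smul_add_self_mem_of_lineEven hΦ hp2 heven hc P

/-- **`(E[p]/Φ₀)^H = 0` for every `H ≤ Γ_ℚ` containing a complex conjugation** (`Φ₀` even, `p`
odd) — GV p. 29 "`H⁰(ℚ_∞, A_ψ) = 0`" at the residual level. [cite: GreenbergVatsal2000, §2 p. 29] -/
theorem forall_fixed_quot_eq_zero (hp2 : p ≠ 2) (heven : LineEven W p Φ₀)
    (H : Subgroup (absoluteGaloisGroup ℚ)) {c : absoluteGaloisGroup ℚ} (hcH : c ∈ H)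
    (hc : IsComplexConjugation (Rat.castHom ℝ) c) (y : (lineSub Φ₀ hΦ).Quot)
    (hy : ∀ h : H, h • y = y) : y = 0 := by
  have hpr : p.Prime := Fact.out
  refine ResidualDevissage.forall_fixed_eq_zero_of_smul_eq_neg (H := H) (hpr.odd_of_ne_two hp2)
    (fun y ↦ (lineSub Φ₀ hΦ).nsmul_quot_eq_zero (fun m ↦ ?_) y) (h := ⟨c, hcH⟩)
    (fun y ↦ smul_quot_eq_neg_of_lineEven hΦ hp2 heven hc y) y hy
  apply Subtype.ext
  rw [AddSubmonoidClass.coe_nsmul, ZeroMemClass.coe_zero]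
  exact AddSubgroup.torsionBy.nsmul_iff.mp m.2

include hΦ in
/-- **No rational `p`-torsion in Greenberg–Vatsal's first case**: if `E[p]` has a rational line
`Φ₀` that is ramified at `p` and even (`p` odd), then `E[p]^{Γ_ℚ} = 0` — a `Γ_ℚ`-fixed `P ≠ 0` would
lie in `Φ₀` (`c • P + P = 2P ∈ Φ₀`) and span it, making `Φ₀` unramified. So GV's hypothesis
"`H⁰(ℚ, A[π]) = 0`" of Prop. (2.8) and the correction term `t = dim E(ℚ)[p]` vanish in case 1.
[cite: GreenbergVatsal2000, §2 Prop. (2.8), p. 28] -/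
theorem eq_zero_of_forall_smul_eq (hp2 : p ≠ 2) (hram : ¬ LineUnramifiedAt W p Φ₀)
    (heven : LineEven W p Φ₀) (P : geomTorsion W (p : ℤ))
    (hP : ∀ g : absoluteGaloisGroup ℚ, g • P = P) : P = 0 := by
  by_contra hP0
  have hpr : p.Prime := Fact.out
  obtain ⟨c, hc⟩ := exists_isComplexConjugation (Rat.castHom ℝ)
  have h2 : (2 : ℕ) • P ∈ Φ₀ := by
    rw [two_nsmul]
    nth_rewrite 1 [← hP c]
    exact smul_add_self_mem_of_lineEven hΦ hp2 heven hc P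
  have hPΦ : P ∈ Φ₀ := TateLineDecomposition.mem_of_two_nsmul_mem W p hp2 Φ₀ h2
  -- `ℤP = Φ₀`
  have hle : AddSubgroup.zmultiples P ≤ Φ₀ := AddSubgroup.zmultiples_le.mpr hPΦ
  have hcardP : Nat.card (AddSubgroup.zmultiples P) = p := by
    rw [Nat.card_zmultiples, addOrderOf_eq_prime (nsmul_eq_zero_of_mem_geomTorsion P) hP0]
  haveI : Finite Φ₀ := Nat.finite_of_card_ne_zero (by rw [hΦ.1]; exact hpr.ne_zero)
  have heq : AddSubgroup.zmultiples P = Φ₀ :=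
    AddSubgroup.eq_of_le_of_card_ge hle (by rw [hΦ.1, hcardP])
  -- hence `Γ_ℚ` fixes `Φ₀` pointwise: `Φ₀` is unramified
  refine hram fun v _ 𝔓 _ σ _ Q hQ ↦ ?_
  rw [← heq] at hQ
  obtain ⟨k, rfl⟩ := AddSubgroup.mem_zmultiples_iff.mp hQ
  change DistribSMul.toAddMonoidHom (geomTorsion W (p : ℤ)) σ (k • P) = _
  rw [map_zsmul, DistribSMul.toAddMonoidHom_apply, hP σ]

/-- A complex conjugation lies in `Gal(ℚ̄/ℚ_∞)` for EVERY `ℤ_p`-extension `κ` (`c² = 1` and `ℤ_p`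
is torsion-free). [folklore] -/
theorem mem_kerSubgroup_of_isComplexConjugation (κ : ZpExtension ℚ p) {c : absoluteGaloisGroup ℚ}
    (hc : IsComplexConjugation (Rat.castHom ℝ) c) : c ∈ κ.kerSubgroup := by
  rw [ZpExtension.mem_kerSubgroup]
  have h2 : κ c ^ 2 = 1 := by rw [← map_pow, hc.sq_eq_one, map_one]
  have h2' : (2 : ℤ) • Multiplicative.toAdd (κ c) = 0 := by
    have := congrArg Multiplicative.toAdd h2
    rwa [toAdd_pow, toAdd_one, ← natCast_zsmul] at this
  rcases (smul_eq_zero.mp h2') with h | h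
  · exact absurd h (by norm_num)
  · exact h

/-! ## §4. The devissage count for `S^{Σ₀}_{E[p]}(L)` -/

omit hp [W.IsElliptic] in
/-- Orbit maps of `E[p^∞][p]` are continuous. [folklore] -/
theorem continuous_smul_torsion (m : (↥(W.geomPrimaryTorsion p))[(p : ℤ)]) :
    Continuous fun g : absoluteGaloisGroup ℚ ↦ g • m :=
  continuous_of_injective_comp (ι := ((↥(W.geomPrimaryTorsion p))[(p : ℤ)]).subtype)
    Subtype.val_injective (GreenbergVatsalTorsionCurve.continuous_smul_curve W p (m : _))

/-- **THE DEVISSAGE OF `S^{Σ₀}_{E[p]}(L)` ALONG THE RAMIFIED-EVEN RATIONAL LINE (GV (16), `E`-side).**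
`E/ℚ` elliptic, `p` odd; `Φ₀ ≤ E[p]` a rational line, ramified at `p` and even (first case of
`GVPar`); `L` Greenberg data on `E[p^∞]` above `p` with `I_p` trivial on the graded piece and
residual line of order `p` (reduction datum at good ordinary `p` / Tate datum at `p ‖ N`);
`Σ₀ ⊇` the bad places prime to `p`; `H ≤ Γ_ℚ` normal containing a complex conjugation (e.g.
`Gal(ℚ̄/ℚ_∞)`). Then, granted the lifting property `S^{Σ₀}_{E[p]/Φ₀}(L) ⊆ q_* H¹(ℚ_Σ/L, E[p])`
(GV: `H²(ℚ_Σ/ℚ_∞, Φ) = 0`):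
`#S^{Σ₀}_{E[p]}(L) = #H¹(ℚ_Σ/L, Φ₀) · #S^{Σ₀}_{E[p]/Φ₀}(L)`.
[cite: GreenbergVatsal2000, §2 pp. 28–30 (display (16))] -/
theorem natCard_gvSelmer_torsion_eq_mul_of_line (hp2 : p ≠ 2)
    (hram : ¬ LineUnramifiedAt W p Φ₀) (heven : LineEven W p Φ₀)
    (L : Data ℚ (W.geomPrimaryTorsion p) p)
    (htriv : ∀ (v : HeightOneSpectrum (𝓞 ℚ)) (hv : ((p : ℕ) : 𝓞 ℚ) ∈ v.asIdeal),
      ∀ x ∈ inertia v, ∀ m : W.geomPrimaryTorsion p, x • m - m ∈ (L v hv).plus)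
    (hcard : ∀ (v : HeightOneSpectrum (𝓞 ℚ)) (hv : ((p : ℕ) : 𝓞 ℚ) ∈ v.asIdeal),
      Nat.card ↥((L v hv).plus ⊓ (↥(W.geomPrimaryTorsion p))[(p : ℤ)]) = p)
    (S₀ : Set (HeightOneSpectrum (𝓞 ℚ)))
    (hS : ∀ v : HeightOneSpectrum (𝓞 ℚ), v ∉ S₀ → ((p : ℕ) : 𝓞 ℚ) ∉ v.asIdeal →
      W.HasGoodReductionAt v)
    (H : Subgroup (absoluteGaloisGroup ℚ)) [H.Normal] {c : absoluteGaloisGroup ℚ} (hcH : c ∈ H)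
    (hc : IsComplexConjugation (Rat.castHom ℝ) c)
    (hlift : ∀ s ∈ quotSelmer H (lineSub Φ₀ hΦ).Quot p S₀,
      ∃ x ∈ GreenbergVatsal2000.unramifiedOutside H ↥((↥(W.geomPrimaryTorsion p))[(p : ℤ)]) p S₀,
        subH1 H (lineSub Φ₀ hΦ).proj (lineSub Φ₀ hΦ).proj_smul x = s) :
    Nat.card (gvSelmer H ↥((↥(W.geomPrimaryTorsion p))[(p : ℤ)]) p (torsionData L p) S₀) =
      Nat.card (GreenbergVatsal2000.unramifiedOutside H (lineSub Φ₀ hΦ).Sub p S₀) *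
        Nat.card (quotSelmer H (lineSub Φ₀ hΦ).Quot p S₀) := by
  set S := lineSub Φ₀ hΦ with hSdef
  rw [GreenbergVatsalTateDatumCofree.gvSelmer_eq_datumSelmer]
  refine natCard_datumSelmer_eq_mul (i := S.incl) (q := S.proj) S.incl_smul S.proj_smul
    (continuous_smul_torsion (W := W) (p := p)) S.incl_injective S.proj_surjective
    S.mem_range_incl_of_proj_eq_zero S.proj_incl ?_ ?_ ?_ hlift
  · -- `E[p^∞][p]` is unramified outside `S₀ ∪ {p}`
    intro v hv hpv x hx m
    apply Subtype.ext
    rw [AddSubgroup.torsionBy.coe_smul]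
    exact GreenbergVatsalTorsionCurve.unramified_outside W p S₀ hS v hv hpv x hx _
  · -- the residual datum is the line
    intro v hv
    rw [S.ker_proj]
    exact torsionData_plus_eq_lineSub hΦ hram hv (L v hv) (htriv v hv) (hcard v hv)
  · -- `(E[p]/Φ₀)^H = 0`
    exact ResidualDevissage.surjOn_fixed_of_forall_fixed_eq_zero S.proj
      (fun y hy ↦ forall_fixed_quot_eq_zero hΦ hp2 heven H hcH hc y hy)

end Summit.BirchSwinnertonDyer.Rank1Residual.X2.ResidualDevissageLine

end
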